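import Summits.BirchSwinnertonDyer.BirchSwinnertonDyer.Theorems.ManinLocalTwoThreeKLineCubeRootDictionaryC
import Summits.BirchSwinnertonDyer.BirchSwinnertonDyer.Theorems.ManinLocalTwoThreeKummerMinimalDictionary
import HarnessLib

/-!
# The `K`-rational Kummer/UDC line, analytic engines II: (DICT) with COMPLEX ordinate — `Σ gₙqⁿ = κ·(t_W∘φ)·W_{u,e}(c·E_f)` for the minimal
# renormalisation `g` of a complex cube root `h`
(route `ManinLocalTwoThree`, crux C3 `ManinPrimeToThreeAtNine` stmt-BirchSwinnertonDyer-22968 — residual RES₃♭, -an g39's `K`-line MEMO-an §82,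
node (AN♮)_K `KummerCubeRootCongruenceOfBoundedKOfUDC`; cell bsd-f2-manin, prover seat p2 gen 18; `--supports stmt-BirchSwinnertonDyer-22968`)

**`kummerMinimalDictionaryC`** — the C3 LEAD's (DICT) `MinimalDictionary.kummerMinimalDictionary_holds` (p733079) RE-RUN for a `3`-torsion point
`T = (X₀, Y₀)` of the short model with `X₀ ∈ ℚ` and COMPLEX ordinate `Y₀` (the `K`-rational point of -an g39's `K`-line), slope `α = (3X₀² + a₄)/(2Y₀)`,
a complex formal cube root `h ∈ ℂ⟦q⟧` of the tangent-line Kummer series (`h(0) = −1`) and ANY `g ∈ ℂ⟦q⟧` with `c·(z·g) = z_W·h`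
(`z_W = exp_W(c·Σaₙqⁿ/n)`): there are `κ ≠ 0` and `B` with, for `Im τ > B`, `c·E_f(τ) ∉ Λ`, `(y_W∘φ)(τ) ≠ 0` and
`Σ gₙ𝕢₁(τ)ⁿ = κ · kummerMinBlock D u (m₁η₁ + m₂η₂) τ`.  DEF-FREE statement (the series and the slope written out; an's `kummerCubeSeriesC` /
`tangentSlopeC` are instances by `rfl`).  Proof = the LEAD's §3 assembly verbatim over the complex-ordinate leaf
`KLine.exists_hasSum_const_mul_shortT_mul_sigmaCubeRoot_of_lift_C` (p2, engines I) and the LEAD's `T`-free germs `exists_qGerm_shortT`,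
`exists_qGerm_minimalParam`, `exists_dslope_factor` (p732527/p733079) and p2's `WitnessInvariance.exists_minimal_package` (p731147).

HONEST FRAMING.  Engine only; (AN♮)_K, KLINE, RES₃♭, C3, Manin's conjecture and BSD are NOT proved here.  No sorry, no new axioms. [folklore]
-/

set_option autoImplicit false
-- lint-debt: the directory name repeats the summit name (sibling precedent `ManinLocalTwoThreeKummerMinimalDictionary.lean`)
set_option linter.dupNamespace false

noncomputable section

open scoped Topology PeriodPair
open Complex Filter PowerSeries
open UpperHalfPlane hiding I
open WeierstrassCurve Literature.NumberTheory.EllipticCurves Literature.NumberTheory.EllipticCurves.ModularForms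
open Summit.BirchSwinnertonDyer.Rank1Residual.ManinAdditive.CuspidalKummer
open Summit.BirchSwinnertonDyer.Rank1Residual.ManinAdditive.CuspidalKummerThree
open Summit.BirchSwinnertonDyer.Rank1Residual.ManinAdditive.KummerCubeMonodromy
open Summit.BirchSwinnertonDyer.Rank1Residual.ManinAdditive.UDCKummerWitnessLine
open Summit.BirchSwinnertonDyer.BirchSwinnertonDyer.Theorems.ManinLocalTwoThree.KummerCubeAnalytic
open Summit.BirchSwinnertonDyer.BirchSwinnertonDyer.Theorems.ManinLocalTwoThree.KummerCubeSigmaLeaves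
open Summit.BirchSwinnertonDyer.BirchSwinnertonDyer.Theorems.ManinLocalTwoThree.KummerCubeRootDictionary
open Summit.BirchSwinnertonDyer.BirchSwinnertonDyer.Theorems.ManinLocalTwoThree.MinimalDictionary

namespace Summit.BirchSwinnertonDyer.BirchSwinnertonDyer.Theorems.ManinLocalTwoThree.KLine

variable {W : WeierstrassCurve ℚ} {N : ℕ} [NeZero N]

/-- **(DICT) with complex ordinate (`kummerMinimalDictionaryC`).**  See the file header. [folklore] -/
theorem kummerMinimalDictionaryC [W.IsElliptic] [W.IsGloballyMinimal]
    (D : ModularParametrizationData W N) (a : ℕ → ℤ) (ha : ∀ n, (a n : ℂ) = cuspCoeff D.f n)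
    (X₀ : ℚ) (Y₀ α : ℂ) {u : ℂ} (hu : u ∉ D.L.lattice) {m₁ m₂ : ℤ} (hm : 3 * u = m₁ * D.L.ω₁ + m₂ * D.L.ω₂)
    (hX : (D.c : ℂ) ^ 2 * ℘[D.L] u = (X₀ : ℂ)) (hY : (D.c : ℂ) ^ 3 * ℘'[D.L] u / 2 = Y₀)
    (hα : α = (3 * (X₀ : ℂ) ^ 2 + ((shortModel W D.c).a₄ : ℂ)) / (2 * Y₀))
    (z : ℚ⟦X⟧) (hz : IsParamGerm W D.c a z) (h : ℂ⟦X⟧)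
    (hh3 : h ^ 3 = PowerSeries.map (algebraMap ℚ ℂ) ((shortModel W D.c).formalYMulCube.subst z)
            - Y₀ • PowerSeries.map (algebraMap ℚ ℂ) (z ^ 3)
            - α • PowerSeries.map (algebraMap ℚ ℂ) ((shortModel W D.c).formalXMulSq.subst z * z - X₀ • z ^ 3))
    (hh0 : constantCoeff h = -1) (g : ℂ⟦X⟧)
    (hg : (D.c : ℂ) • (PowerSeries.map (algebraMap ℚ ℂ) z * g) =
      PowerSeries.map (algebraMap ℚ ℂ) (W.formalExp.subst ((D.c : ℚ) • lSeriesLog a)) * h) :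
    ∃ κ : ℂ, κ ≠ 0 ∧ ∃ B : ℝ, ∀ τ : ℍ, B < τ.im →
      (D.c : ℂ) * eichlerIntegral D.f τ ∉ D.L.lattice ∧ minimalY D τ ≠ 0 ∧
      HasSum (fun n : ℕ ↦ coeff n g * Function.Periodic.qParam 1 (τ : ℂ) ^ n)
        (κ * kummerMinBlock D u (m₁ * D.L.η₁ + m₂ * D.L.η₂) τ) := by
  -- adapted from `MinimalDictionary.kummerMinimalDictionary_holds` (C3 LEAD p1 g16, p733079)
  have hc0 : D.c ≠ 0 := D.maninConstant_ne_zero_holds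
  have hc : (D.c : ℂ) ≠ 0 := Int.cast_ne_zero.mpr hc0
  set zWq : ℚ⟦X⟧ := W.formalExp.subst ((D.c : ℚ) • lSeriesLog a) with hzWq
  set e : ℂ := m₁ * D.L.η₁ + m₂ * D.L.η₂ with he
  -- §1: `Σ hₙqⁿ = κ₀·t_s·W`
  obtain ⟨κ₀, B₁, hκ₀, hH'⟩ :=
    exists_hasSum_const_mul_shortT_mul_sigmaCubeRoot_of_lift_C D a ha X₀ Y₀ α hu hm hX hY hα z hz h hh3 hh0
  obtain ⟨H, hHan, hTH, B₂, hHval⟩ := exists_analyticAt_of_hasSum_qParam hH'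
  -- §2: the two parameter germs and their `dslope` factorisations
  obtain ⟨Z, hZan, hZ0, hTZ, B₃, hZval⟩ := exists_qGerm_shortT W D a ha hc0 z hz
  obtain ⟨ZW, hZWan, hZW0, hTZW, hZWval⟩ := exists_qGerm_minimalParam W D a ha hc0
  obtain ⟨Z₁, hZ₁an, hZfac, hTZ₁⟩ := exists_dslope_factor hZan hZ0
  obtain ⟨ZW₁, hZW₁an, hZWfac, hTZW₁⟩ := exists_dslope_factor hZWan hZW0
  have hz1 : coeff 1 z = 1 := MinimalCubeRoot.coeff_one_shortGerm W D a ha hz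
  have hZ₁0 : Z₁ 0 = 1 := by
    have h1 := congrArg (coeff 1) hTZ₁
    rw [hTZ, coeff_map, hz1, map_one, show (1 : ℕ) = 0 + 1 from rfl, coeff_succ_X_mul,
      coeff_zero_eq_constantCoeff_apply, constantCoeff_taylorAt0] at h1
    exact h1.symm
  -- the germ `𝒢 = ZW₁·H/(c·Z₁)`
  set 𝒢 : ℂ → ℂ := fun q => ZW₁ q * H q / ((D.c : ℂ) * Z₁ q) with h𝒢
  have hden0 : (D.c : ℂ) * Z₁ 0 ≠ 0 := by rw [hZ₁0, mul_one]; exact hc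
  have h𝒢an : AnalyticAt ℂ 𝒢 0 := (hZW₁an.mul hHan).div (analyticAt_const.mul hZ₁an) hden0
  have hZ₁ne : ∀ᶠ q in 𝓝 (0 : ℂ), (D.c : ℂ) * Z₁ q ≠ 0 :=
    (analyticAt_const.mul hZ₁an).continuousAt.eventually_ne hden0
  have hprod : taylorAt0 𝒢 * (C (D.c : ℂ) * taylorAt0 Z₁) = taylorAt0 ZW₁ * taylorAt0 H := by
    have h1 : taylorAt0 (fun q => 𝒢 q * ((D.c : ℂ) * Z₁ q)) = taylorAt0 (fun q => ZW₁ q * H q) := by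
      apply taylorAt0_congr
      filter_upwards [hZ₁ne] with q hq
      rw [h𝒢]
      simp only
      rw [div_mul_cancel₀ _ hq]
    have h2 : taylorAt0 (fun q => 𝒢 q * ((D.c : ℂ) * Z₁ q)) = taylorAt0 𝒢 * (C (D.c : ℂ) * taylorAt0 Z₁) := by
      have hcz : taylorAt0 (fun q => (D.c : ℂ) * Z₁ q) = C (D.c : ℂ) * taylorAt0 Z₁ :=
        Literature.NumberTheory.Transcendental.AndreCriterion.taylor_const_mul (D.c : ℂ) Z₁
      rw [← hcz]
      exact taylorAt0_mul h𝒢an (analyticAt_const.mul hZ₁an)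
    have h3 : taylorAt0 (fun q => ZW₁ q * H q) = taylorAt0 ZW₁ * taylorAt0 H := taylorAt0_mul hZW₁an hHan
    rw [← h2, h1, h3]
  have hT𝒢 : taylorAt0 𝒢 = g := by
    have hrel : C (D.c : ℂ) * z.map (algebraMap ℚ ℂ) * g = PowerSeries.map (algebraMap ℚ ℂ) zWq * h := by
      rw [smul_eq_C_mul] at hg
      rw [hzWq, ← hg, mul_assoc]
    have hrel' : C (D.c : ℂ) * z.map (algebraMap ℚ ℂ) * taylorAt0 𝒢 = PowerSeries.map (algebraMap ℚ ℂ) zWq * h := by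
      rw [← hTZ, ← hTZW, ← hTH, hTZ₁, hTZW₁]
      linear_combination X * hprod
    have hzne : C (D.c : ℂ) * z.map (algebraMap ℚ ℂ) ≠ 0 := by
      refine mul_ne_zero ?_ ?_
      · intro h0
        have := congrArg constantCoeff h0
        rw [constantCoeff_C, map_zero] at this
        exact hc this
      · intro h0
        have := congrArg (coeff 1) h0
        rw [coeff_map, hz1, map_one, map_zero] at this
        exact one_ne_zero this
    have := hrel'.trans hrel.symm
    rw [mul_comm (C (D.c : ℂ) * z.map (algebraMap ℚ ℂ)) (taylorAt0 𝒢),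
      mul_comm (C (D.c : ℂ) * z.map (algebraMap ℚ ℂ))] at this
    exact mul_right_cancel₀ hzne this
  obtain ⟨r, hr, hsum⟩ := exists_hasSum_taylorAt0 h𝒢an
  -- side conditions high in the strip
  obtain ⟨Q, A, hQd, -, hQ0, -, hYQ, -⟩ := WitnessInvariance.exists_minimal_package D hc0 u e
  have hf1 : cuspCoeff D.f 1 = 1 := by
    rw [D.isNewformOf.2 1, W.isMultiplicative_LFunction.map_one]; simp
  obtain ⟨B₄, hB₄⟩ := exists_im_bound_of_eventually
    (eventually_smul_qGerm_notMem D.f hf1 D.L hc hQd.continuous.continuousAt (by rw [hQ0]; norm_num))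
  have hev5 : ∀ᶠ q in 𝓝[≠] (0 : ℂ), Z₁ q ≠ 0 ∧ ‖q‖ < r := by
    have h1 : ∀ᶠ q in 𝓝 (0 : ℂ), Z₁ q ≠ 0 := hZ₁an.continuousAt.eventually_ne (by rw [hZ₁0]; exact one_ne_zero)
    have h2 : ∀ᶠ q in 𝓝 (0 : ℂ), ‖q‖ < r := by
      have : Metric.ball (0 : ℂ) r ∈ 𝓝 (0 : ℂ) := Metric.ball_mem_nhds 0 hr
      filter_upwards [this] with q hq
      rwa [Metric.mem_ball, dist_zero_right] at hq
    exact (h1.and h2).filter_mono nhdsWithin_le_nhds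
  obtain ⟨B₅, hB₅⟩ := exists_im_bound_of_eventually hev5
  refine ⟨κ₀ / (D.c : ℂ), div_ne_zero hκ₀ hc, max (max B₂ B₃) (max B₄ B₅), fun τ hτ => ?_⟩
  have h23 : max B₂ B₃ < τ.im := (le_max_left _ _).trans_lt hτ
  have h45 : max B₄ B₅ < τ.im := (le_max_right _ _).trans_lt hτ
  have h2 : B₂ < τ.im := (le_max_left _ _).trans_lt h23
  have h3 : B₃ < τ.im := (le_max_right _ _).trans_lt h23
  have h4 : B₄ < τ.im := (le_max_left _ _).trans_lt h45
  have h5 : B₅ < τ.im := (le_max_right _ _).trans_lt h45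
  set q : ℂ := Function.Periodic.qParam 1 (τ : ℂ) with hq
  set w : ℂ := (D.c : ℂ) * eichlerIntegral D.f τ with hw
  obtain ⟨hwΛ, hQw⟩ := hB₄ τ h4
  rw [qGerm_apply] at hwΛ hQw
  obtain ⟨hZ₁q, hqr⟩ := hB₅ τ h5
  have hσw : D.L.weierstrassSigma w ≠ 0 := fun h0 => hwΛ ((D.L.weierstrassSigma_eq_zero_iff_holds w).mp h0)
  have hYne : minimalY D τ ≠ 0 := by
    rw [hYQ τ hwΛ]
    exact div_ne_zero (mul_ne_zero (div_ne_zero (pow_ne_zero 3 hc) two_ne_zero) hQw) (pow_ne_zero 3 hσw)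
  refine ⟨hwΛ, hYne, ?_⟩
  have hq0 : q ≠ 0 := by
    rw [hq, ← norm_pos_iff, Function.Periodic.norm_qParam]; exact Real.exp_pos _
  have htne : shortT D τ ≠ 0 := by
    rw [← hZval τ h3, hZfac]; exact mul_ne_zero hq0 hZ₁q
  have hval : 𝒢 q = κ₀ / (D.c : ℂ) * kummerMinBlock D u e τ := by
    have hZW₁q : ZW₁ q = minimalParam D τ / q := by
      rw [eq_div_iff hq0, mul_comm, ← hZWfac]; exact hZWval τ hwΛ
    have hZ₁q' : Z₁ q = shortT D τ / q := by
      rw [eq_div_iff hq0, mul_comm, ← hZfac]; exact hZval τ h3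
    rw [h𝒢]
    simp only
    rw [hZW₁q, hZ₁q', hHval τ h2, kummerMinBlock, ← hw, ← he]
    field_simp
  have hs := hsum q hqr
  rw [hT𝒢, hval] at hs
  exact hs

end Summit.BirchSwinnertonDyer.BirchSwinnertonDyer.Theorems.ManinLocalTwoThree.KLine

end
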